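import Mathlib
import Literature.NumberTheory.LFunctions.Zhang2022.Section14Eq146Leg1
import Literature.NumberTheory.LFunctions.Zhang2022.Section14Eq146Leg2
import Literature.NumberTheory.LFunctions.Zhang2022.Section14Eq148Leg2Aggregation
import Literature.NumberTheory.LFunctions.Zhang2022.Section14U017Generic
import Literature.NumberTheory.LFunctions.Zhang2022.ToolkitBErrorChainBlock
import HarnessLib

/-!
# Zhang (2022) §14, (14.6): the large-conductor leg at the modulus `D₂k` HOLDS (`leg2₂`), hence the
# weighted (14.6) (W-146) and `Typed.Sec14.Eq146` — kernel-checked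

Topic `Literature/NumberTheory/LFunctions/Zhang2022` (Landau–Siegel audit tree; verdict-neutral).
Y. Zhang, *Discrete mean estimates and the Landau–Siegel zero*, arXiv:2211.02515v1 (2022)
[Zhang2022LandauSiegel] — **an unrefereed manuscript under adjudication**; nothing here asserts or
denies its Theorems 1–2 or Proposition 14.1 (whose remaining input, the large-conductor leg of (14.8)
at the modulus `Dk`, is another seat's). ZHANG-L discharge lane, WP14, node «leg2₂» (WP14-PLAN v1.1
§2.1) under the leaf `Skeleton.Prop141`; rows G-adj2-4, G-L3t7-1.

(14.6) (p. 78) is "similar" to (14.5) (p. 79, tex L3966–L3969); for the conductors `D³ ≤ r ≤ 2D₂P₄`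
one uses "the Mellin transform, Lemma 5.4 (i) and the large sieve inequality" (p. 79, tex L3962–L3963)
"in a way similar to the proof of Proposition 7.1" — i.e. §7 (7.15): dyadic blocks `R ≤ r < 2R`, the
localisation `𝔰 ↦ 𝔰*`, Cauchy–Schwarz against the two large-sieve mean squares, and the weight
`(φ(hr)h√r)⁻¹ ≈ R^{−3/2}`. All of this is in the tree as COEFFICIENT-GENERIC theorems; this file only
instantiates:

* the per-block bound `BErrorChain.dyadic_block_bound_frakSGen_tau5_filter` (zl-libA-p2 and zl-libA-p6,
  `ToolkitBErrorChainBlock`) at `c(l) = κ*(D₁d·l)` (dilation `d ↦ D₁d ≤ 2DP₄ < P`), `w(p) = χ(p)(pt₀)^β`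
  (`|w| ≤ e^{15π}`, `norm_wt_le`), filter `θ*↑ ≠ χ↑`; block constant `C·|B|·e^{15π}·τ₅(D₁)`
  (`τ₅(D₁dl) ≤ τ₅(D₁d)τ₅(l)`, `τ₅(D₁d) ≤ τ₅(D₁)τ₅(d)`);
* the dyadic aggregation `largeR_sum_le_of_blocks` (zl-libB-typer, `Section14Eq148Leg2Aggregation`;
  prefactor `D ≥ D₂`, `X = ⌊2D₂P₄⌋ + 1 ≤ 2DP₄ + 1`, `h`-sets the `D₂/(D₂,r) ∣ h` filter, `𝓛^{5396} ≤ D^{1/8}`);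
* `τ₅(D₁) ≤ C_τ·D^{1/8}` (`MeanSquareMajorant.exists_tau_le_mul_rpow`), giving `≤ C'·P²·D^{−1/4}`.

Results: `leg2₂_holds` (= hypothesis `hleg2` of `eq146W_of_legs`), and by composition with
`leg1₂_holds` (zl-w14-p1, `Section14Eq146Leg1`): `eq146W_holds` (W-146, the hypothesis `h146` of
`prop141_of_parts` / third input of `prop141_of_legs`) and `eq146_holds : Typed.Sec14.Eq146`
((14.6) AS TYPED, by name). No Assumption (A) is used beyond passing it on; no new definitions.

## References

* Y. Zhang, arXiv:2211.02515v1 (2022), §14 (14.6) p. 78, (14.8) proof p. 79 (tex L3915,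
  L3956–L3969); §7 (7.15) pp. 38–39. [cite: Zhang2022LandauSiegel, §14 (14.6), (14.8) pp.78–79]
-/

noncomputable section

open Complex Real ComplexConjugate

namespace Literature.NumberTheory.LFunctions.Zhang2022.Typed.Sec14

open Skeleton DirichletCharacter
open Literature.NumberTheory.LFunctions.Zhang2022.Section7cStatements (dyadic)
open Literature.NumberTheory.LFunctions.Zhang2022.BErrorChain (frakSGen)
open scoped Classical

/-! ## The inner quantity of the (14.6) leg as a `frakSGen` -/

/-- The inner `θ'`-sum of the (14.6) majorant is the sum of `‖𝔰_gen(r,h;θ')‖` with coefficients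
`κ*(D₁d·)` and weight `χ·(pt₀)^β` over the primitive `θ' (mod r)` with `θ'↑ ≠ χ↑` (reordering
`(χ(p)(pt₀)^β)θ̄'(p) = χ(p)θ̄'(p)(pt₀)^β`; `finsetOf = univ.filter`).
[cite: Zhang2022LandauSiegel, §14 u017/(14.8) p.79; §7 p.37 tex L2001] -/
theorem inner146_eq_sum_frakSGen {D : ℕ} (χ : DirichletCharacter ℂ D) (β : ℂ) (κs : ℕ → ℂ)
    (D₁ d h r : ℕ) :
    ∑ θ' ∈ finsetOf {θ' : DirichletCharacter ℂ r | θ'.IsPrimitive ∧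
        changeLevel (dvd_mul_left r D) θ' ≠ changeLevel (dvd_mul_right D r) χ},
      ‖∑' l : ℕ, if Nat.Coprime l h then κs (D₁ * d * l) * θ' (l : ZMod r) *
          ∑ p ∈ primeWindow D, χ (p : ZMod D) * θ'⁻¹ (p : ZMod r) * wt D β p *
            DeltaW D ((l : ℝ) / ((p : ℝ) * h * r)) else 0‖ =
      ∑ θ' ∈ (Finset.univ : Finset (DirichletCharacter ℂ r)).filter
          (fun θ' => θ'.IsPrimitive ∧
            changeLevel (dvd_mul_left r D) θ' ≠ changeLevel (dvd_mul_right D r) χ),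
        ‖frakSGen D (fun l => κs (D₁ * d * l)) (fun p => χ (p : ZMod D) * wt D β p) r h θ'‖ := by
  classical
  rw [BErrorChain.finsetOf_setOf_eq_filter]
  refine Finset.sum_congr rfl fun θ' _ => ?_
  congr 1
  rw [frakSGen]
  refine tsum_congr fun l => ?_
  split_ifs
  · congr 1
    refine Finset.sum_congr rfl fun p _ => ?_
    ring
  · rfl

/-! ## `leg2₂`: the large-conductor leg of (14.6) at the modulus `D₂k` -/

/-- **`leg2₂` HOLDS** — the large-conductor (`D³ ≤ r ≤ 2D₂P₄`) part of the re-indexed (14.6) majorant,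
weight `χ(p)(pt₀)^β` (`‖β‖ < 5α`), is `≤ C·P²·D^{−1/4}` for all large `D` under (A), for all `κ*, a*`
subject to (14.1)–(14.2) and every `D = D₁D₂`, `D₁ > 1` (the hypothesis `hleg2` of `eq146W_of_legs`):
per dyadic block by `BErrorChain.dyadic_block_bound_frakSGen_tau5_filter` at `c = κ*(D₁d·)`,
`w = χ·(pt₀)^β`, aggregated by `largeR_sum_le_of_blocks` (prefactor `D₂ ≤ D`), with
`τ₅(D₁) ≤ C_τD^{1/8}` and `𝓛^{5396} ≤ D^{1/8}`. [cite: Zhang2022LandauSiegel, §14 (14.6), (14.8) proof pp.78–79, tex L3962–L3969] -/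
theorem leg2₂_holds :
    ∀ B : ℝ, ∃ c : ℝ, 0 < c ∧ ∃ C : ℝ, ForAllLarge fun D _ χ => AssumptionA D χ →
      ∀ β : ℂ, ‖β‖ < 5 * alpha D → ∀ κs as : ℕ → ℂ, Eq141 B κs → Eq142 D B as →
        ∀ D₁ D₂ : ℕ, D₁ * D₂ = D → 1 < D₁ →
          ∑ d ∈ Finset.Icc 1 ⌊2 * P4 D⌋₊, (d : ℝ)⁻¹ *
            ∑ r ∈ (Finset.Icc 2 ⌊2 * (D₂ : ℝ) * P4 D⌋₊).filter (fun r => ¬ r < D ^ 3),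
              ∑ h ∈ (Finset.Ico 1 ⌈bigP D / r⌉₊).filter (fun h => D₂ / Nat.gcd D₂ r ∣ h),
                (D₂ : ℝ) / ((Nat.totient (h * r) : ℝ) * h * Real.sqrt r) *
                  ∑ θ' ∈ finsetOf {θ' : DirichletCharacter ℂ r | θ'.IsPrimitive ∧
                      changeLevel (dvd_mul_left r D) θ' ≠ changeLevel (dvd_mul_right D r) χ},
                    ‖∑' l : ℕ, if Nat.Coprime l h then κs (D₁ * d * l) * θ' (l : ZMod r) *
                        ∑ p ∈ primeWindow D, χ (p : ZMod D) * θ'⁻¹ (p : ZMod r) * wt D β p *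
                          DeltaW D ((l : ℝ) / ((p : ℝ) * h * r)) else 0‖
          ≤ C * bigP D ^ 2 * (D : ℝ) ^ (-c) := by
  classical
  intro B
  obtain ⟨C₆, hC₆0, D₆, hblock⟩ := BErrorChain.dyadic_block_bound_frakSGen_tau5_filter
  obtain ⟨Cτ, hCτ1, hCτ⟩ := MeanSquareMajorant.exists_tau_le_mul_rpow 5 (show (0 : ℝ) < 1 / 8 by norm_num)
  obtain ⟨DK, hDK⟩ := exists_ell_pow_le_rpow (5315 + 81) (show (0 : ℝ) < 1 / 8 by norm_num)
  obtain ⟨DT, hDT⟩ := sq_mul_sqrt_three_t0_le_bigT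
  obtain ⟨D₃, hD₃⟩ := exists_nat_forall_le_ell 3
  obtain ⟨Dp, hDp⟩ := exists_natCast_mul_two_P4_lt_bigP
  set W : ℝ := Real.exp (15 * π) with hW_def
  have hW0 : 0 ≤ W := (Real.exp_pos _).le
  set M₅ : ℝ := MeanSquareMajorant.majorantConst 5 5 with hM₅
  have hM₅0 : 0 < M₅ := MeanSquareMajorant.majorantConst_pos 5 5
  refine ⟨1 / 4, by norm_num, 3840 * (C₆ * |B| * W * Cτ) * M₅, ?_⟩
  refine ⟨max (max D₆ DK) (max (max DT D₃) Dp),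
    fun D _ χ hD hq hprim hA β hβ κs as h141 h142 D₁ D₂ hD₁₂ hD₁ => ?_⟩
  have hD₆ : D₆ ≤ D := le_trans (le_trans (le_max_left _ _) (le_max_left _ _)) hD
  have hDK' : DK ≤ D := le_trans (le_trans (le_max_right _ _) (le_max_left _ _)) hD
  have hDT' : DT ≤ D := le_trans (le_trans (le_trans (le_max_left _ _) (le_max_left _ _)) (le_max_right _ _)) hD
  have hD₃' : D₃ ≤ D := le_trans (le_trans (le_trans (le_max_right _ _) (le_max_left _ _)) (le_max_right _ _)) hD
  have hDp' : Dp ≤ D := le_trans (le_trans (le_max_right _ _) (le_max_right _ _)) hD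
  have hL3 : 3 ≤ ell D := hD₃ D hD₃'
  have hDne : D ≠ 0 := NeZero.ne D
  have hD0 : (0 : ℝ) < D := by exact_mod_cast Nat.pos_of_ne_zero hDne
  have hD1 : (1 : ℝ) ≤ D := by exact_mod_cast Nat.pos_of_ne_zero hDne
  have hB0 : 0 ≤ B := (norm_nonneg _).trans (h142.1 0)
  have hP0 : 0 < bigP D := Real.exp_pos _
  have hP40 : 0 ≤ P4 D := zero_le_one.trans (one_le_P4_of_three_le hL3)
  have hD₂1 : 1 ≤ D₂ := Nat.pos_of_ne_zero fun h => by subst h; simp at hD₁₂; exact hDne hD₁₂.symm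
  have hD₂D : D₂ ≤ D := by
    calc D₂ = 1 * D₂ := (one_mul _).symm
      _ ≤ D₁ * D₂ := Nat.mul_le_mul_right _ (by omega)
      _ = D := hD₁₂
  have hD₂Dr : (D₂ : ℝ) ≤ D := by exact_mod_cast hD₂D
  have hD₁D : (D₁ : ℝ) ≤ D := by
    have : D₁ ≤ D := by
      calc D₁ = D₁ * 1 := (mul_one _).symm
        _ ≤ D₁ * D₂ := Nat.mul_le_mul_left _ hD₂1
        _ = D := hD₁₂
    exact_mod_cast this
  -- the weight `w = χ·(pt₀)^β`
  have hw : ∀ p ∈ primeWindow D, ‖χ (p : ZMod D) * wt D β p‖ ≤ W := by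
    intro p hp
    rw [norm_mul]
    calc ‖χ (p : ZMod D)‖ * ‖wt D β p‖ ≤ 1 * W :=
          mul_le_mul (DirichletCharacter.norm_le_one χ _) (norm_wt_le hL3 hp hβ.le) (norm_nonneg _)
            zero_le_one
      _ = W := one_mul _
  -- the block constant `C₆·|B|·W·τ₅(D₁)` and its size
  have hτD₁0 : 0 ≤ MeanSquareMajorant.tau 5 D₁ := MeanSquareMajorant.tau_nonneg _ _
  have hτD₁ : MeanSquareMajorant.tau 5 D₁ ≤ Cτ * (D : ℝ) ^ (1 / 8 : ℝ) := by
    refine (hCτ D₁).trans (mul_le_mul_of_nonneg_left ?_ (by linarith))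
    exact Real.rpow_le_rpow (Nat.cast_nonneg _) hD₁D (by norm_num)
  set Cb : ℝ := C₆ * |B| * W * MeanSquareMajorant.tau 5 D₁ with hCb
  have hCb0 : 0 ≤ Cb := by rw [hCb]; positivity
  -- the inner quantity
  set V : ℕ → ℕ → ℕ → ℝ := fun d h r =>
    ∑ θ' ∈ finsetOf {θ' : DirichletCharacter ℂ r | θ'.IsPrimitive ∧
        changeLevel (dvd_mul_left r D) θ' ≠ changeLevel (dvd_mul_right D r) χ},
      ‖∑' l : ℕ, if Nat.Coprime l h then κs (D₁ * d * l) * θ' (l : ZMod r) *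
          ∑ p ∈ primeWindow D, χ (p : ZMod D) * θ'⁻¹ (p : ZMod r) * wt D β p *
            DeltaW D ((l : ℝ) / ((p : ℝ) * h * r)) else 0‖ with hV
  have hV0 : ∀ d h r, 0 ≤ V d h r := fun d h r => Finset.sum_nonneg fun _ _ => norm_nonneg _
  -- the per-block bound at `c = κ*(D₁d·)`
  have hblk : ∀ (d h : ℕ) (R : ℝ), 0 < d → (d : ℝ) ≤ 2 * P4 D → 0 < h →
      (D : ℝ) ^ 3 ≤ R → R ≤ 3 * (D : ℝ) * P4 D → (h : ℝ) * R < bigP D →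
      R ^ (-(3 / 2 : ℝ)) * ∑ r ∈ dyadic R, V d h r ≤
        Cb * MeanSquareMajorant.tau 5 d * h * ell D ^ 5315 *
          (R ^ (1 / 2 : ℝ) * bigP D ^ (3 / 2 : ℝ) + R ^ (-(1 / 2 : ℝ)) * bigP D ^ 2) := by
    intro d h R hd hd2 hh hR3 _ hhR
    -- `D₁d ≤ D·2P₄ < P`
    have hd' : 0 < D₁ * d := Nat.mul_pos (by omega) hd
    have hd'P : ((D₁ * d : ℕ) : ℝ) ≤ bigP D := by
      push_cast
      have h1 : (D₁ : ℝ) * d ≤ (D : ℝ) * (2 * P4 D) :=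
        mul_le_mul hD₁D hd2 (Nat.cast_nonneg d) hD0.le
      exact h1.trans (hDp D hDp').le
    have hR1 : 1 ≤ R := le_trans (one_le_pow₀ hD1) hR3
    have hRh : R * h ≤ bigP D := by rw [mul_comm]; exact hhR.le
    have hc : ∀ l : ℕ, ‖(fun l => κs (D₁ * d * l)) l‖ ≤
        B * MeanSquareMajorant.tau 5 (D₁ * d * l) := fun l => norm_le_tau_of_eq141 h141 _
    have key := hblock D χ hD₆ hq hprim
      (fun r θ' => changeLevel (dvd_mul_left r D) θ' ≠ changeLevel (dvd_mul_right D r) χ)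
      (fun l => κs (D₁ * d * l)) (fun p => χ (p : ZMod D) * wt D β p) B W (D₁ * d) h R
      hc hw hW0 hd' hd'P hh hR1 hRh
    have hVeq : ∑ r ∈ dyadic R, V d h r = ∑ r ∈ dyadic R,
        ∑ θ' ∈ (Finset.univ : Finset (DirichletCharacter ℂ r)).filter
            (fun θ' => θ'.IsPrimitive ∧
              changeLevel (dvd_mul_left r D) θ' ≠ changeLevel (dvd_mul_right D r) χ),
          ‖frakSGen D (fun l => κs (D₁ * d * l)) (fun p => χ (p : ZMod D) * wt D β p) r h θ'‖ :=
      Finset.sum_congr rfl fun r _ => inner146_eq_sum_frakSGen χ β κs D₁ d h r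
    have key' : R ^ (-(3 / 2 : ℝ)) * ∑ r ∈ dyadic R, V d h r ≤
        C₆ * B * W * MeanSquareMajorant.tau 5 (D₁ * d) * (h : ℝ) * ell D ^ 5315 *
          (R ^ (1 / 2 : ℝ) * bigP D ^ (3 / 2 : ℝ) + R ^ (-(1 / 2 : ℝ)) * bigP D ^ 2) := by
      rw [hVeq]
      convert key using 6
    refine key'.trans ?_
    -- `C₆·B·W·τ₅(D₁d) ≤ Cb·τ₅(d)`
    have hτsplit : MeanSquareMajorant.tau 5 (D₁ * d) ≤
        MeanSquareMajorant.tau 5 D₁ * MeanSquareMajorant.tau 5 d := MeanSquareMajorant.tau_mul_le 5 _ _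
    have hrest : 0 ≤ (h : ℝ) * ell D ^ 5315 *
        (R ^ (1 / 2 : ℝ) * bigP D ^ (3 / 2 : ℝ) + R ^ (-(1 / 2 : ℝ)) * bigP D ^ 2) := by
      have : 0 ≤ ell D := by linarith
      positivity
    calc C₆ * B * W * MeanSquareMajorant.tau 5 (D₁ * d) * (h : ℝ) * ell D ^ 5315 *
          (R ^ (1 / 2 : ℝ) * bigP D ^ (3 / 2 : ℝ) + R ^ (-(1 / 2 : ℝ)) * bigP D ^ 2)
        = (C₆ * B * W * MeanSquareMajorant.tau 5 (D₁ * d)) * ((h : ℝ) * ell D ^ 5315 *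
          (R ^ (1 / 2 : ℝ) * bigP D ^ (3 / 2 : ℝ) + R ^ (-(1 / 2 : ℝ)) * bigP D ^ 2)) := by ring
      _ ≤ (C₆ * |B| * W * (MeanSquareMajorant.tau 5 D₁ * MeanSquareMajorant.tau 5 d)) *
          ((h : ℝ) * ell D ^ 5315 *
          (R ^ (1 / 2 : ℝ) * bigP D ^ (3 / 2 : ℝ) + R ^ (-(1 / 2 : ℝ)) * bigP D ^ 2)) := by
          refine mul_le_mul_of_nonneg_right ?_ hrest
          have h1 : C₆ * B * W ≤ C₆ * |B| * W :=
            mul_le_mul_of_nonneg_right (mul_le_mul_of_nonneg_left (le_abs_self B) hC₆0) hW0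
          exact mul_le_mul h1 hτsplit (MeanSquareMajorant.tau_nonneg _ _) (by positivity)
      _ = Cb * MeanSquareMajorant.tau 5 d * h * ell D ^ 5315 *
          (R ^ (1 / 2 : ℝ) * bigP D ^ (3 / 2 : ℝ) + R ^ (-(1 / 2 : ℝ)) * bigP D ^ 2) := by
          rw [hCb]; ring
  -- the aggregation (prefactor `D`), with `X = ⌊2D₂P₄⌋ + 1`, `K = 1`
  have hX1 : 1 ≤ ⌊2 * (D₂ : ℝ) * P4 D⌋₊ + 1 := by omega
  have hXle : ((⌊2 * (D₂ : ℝ) * P4 D⌋₊ + 1 : ℕ) : ℝ) ≤ 2 * (D : ℝ) * P4 D + 1 := by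
    push_cast
    have h1 : (⌊2 * (D₂ : ℝ) * P4 D⌋₊ : ℝ) ≤ 2 * (D₂ : ℝ) * P4 D := Nat.floor_le (by positivity)
    have h2 : 2 * (D₂ : ℝ) * P4 D ≤ 2 * (D : ℝ) * P4 D := by gcongr
    linarith
  have hKD : ell D ^ (5315 + 81) ≤ 1 * (D : ℝ) ^ (1 / 8 : ℝ) := by rw [one_mul]; exact hDK D hDK'
  have hagg := largeR_sum_le_of_blocks hL3 (hDT D hDT') hKD V hV0 hX1 hXle
    (fun r => (Finset.Ico 1 ⌈bigP D / r⌉₊).filter (fun h => D₂ / Nat.gcd D₂ r ∣ h))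
    (fun r => Finset.filter_subset _ _) hblk
  -- prefactor `D₂ ≤ D`, `Icc = Ico (·+1)`
  have hIcc : (Finset.Icc 2 ⌊2 * (D₂ : ℝ) * P4 D⌋₊).filter (fun r => ¬ r < D ^ 3) =
      (Finset.Ico 2 (⌊2 * (D₂ : ℝ) * P4 D⌋₊ + 1)).filter (fun r => ¬ r < D ^ 3) := by
    rw [Finset.Ico_add_one_right_eq_Icc]
  have hmono :
      ∑ d ∈ Finset.Icc 1 ⌊2 * P4 D⌋₊, (d : ℝ)⁻¹ *
        ∑ r ∈ (Finset.Icc 2 ⌊2 * (D₂ : ℝ) * P4 D⌋₊).filter (fun r => ¬ r < D ^ 3),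
          ∑ h ∈ (Finset.Ico 1 ⌈bigP D / r⌉₊).filter (fun h => D₂ / Nat.gcd D₂ r ∣ h),
            (D₂ : ℝ) / ((Nat.totient (h * r) : ℝ) * h * Real.sqrt r) *
              ∑ θ' ∈ finsetOf {θ' : DirichletCharacter ℂ r | θ'.IsPrimitive ∧
                  changeLevel (dvd_mul_left r D) θ' ≠ changeLevel (dvd_mul_right D r) χ},
                ‖∑' l : ℕ, if Nat.Coprime l h then κs (D₁ * d * l) * θ' (l : ZMod r) *
                    ∑ p ∈ primeWindow D, χ (p : ZMod D) * θ'⁻¹ (p : ZMod r) * wt D β p *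
                      DeltaW D ((l : ℝ) / ((p : ℝ) * h * r)) else 0‖ ≤
      ∑ d ∈ Finset.Icc 1 ⌊2 * P4 D⌋₊, (d : ℝ)⁻¹ *
        ∑ r ∈ (Finset.Ico 2 (⌊2 * (D₂ : ℝ) * P4 D⌋₊ + 1)).filter (fun r => ¬ r < D ^ 3),
          ∑ h ∈ (Finset.Ico 1 ⌈bigP D / r⌉₊).filter (fun h => D₂ / Nat.gcd D₂ r ∣ h),
            (D : ℝ) / ((Nat.totient (h * r) : ℝ) * h * Real.sqrt r) * V d h r := by
    rw [hIcc]
    refine Finset.sum_le_sum fun d _ => mul_le_mul_of_nonneg_left ?_ (inv_nonneg.mpr (Nat.cast_nonneg d))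
    refine Finset.sum_le_sum fun r _ => Finset.sum_le_sum fun h _ => ?_
    refine mul_le_mul_of_nonneg_right ?_ (hV0 d h r)
    exact div_le_div_of_nonneg_right hD₂Dr (by positivity)
  refine hmono.trans (hagg.trans ?_)
  -- constants: `3840·max Cb 0·M₅·1·P²·D^{-3/8} ≤ C·P²·D^{-1/4}`
  rw [max_eq_left hCb0, mul_one]
  have hCbD : Cb ≤ C₆ * |B| * W * Cτ * (D : ℝ) ^ (1 / 8 : ℝ) := by
    rw [hCb]
    have : C₆ * |B| * W * MeanSquareMajorant.tau 5 D₁ ≤ C₆ * |B| * W * (Cτ * (D : ℝ) ^ (1 / 8 : ℝ)) :=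
      mul_le_mul_of_nonneg_left hτD₁ (by positivity)
    linarith [this]
  have hP2 : 0 ≤ bigP D ^ 2 := sq_nonneg _
  calc 3840 * Cb * M₅ * bigP D ^ 2 * (D : ℝ) ^ (-(3 / 8 : ℝ))
      ≤ 3840 * (C₆ * |B| * W * Cτ * (D : ℝ) ^ (1 / 8 : ℝ)) * M₅ * bigP D ^ 2 * (D : ℝ) ^ (-(3 / 8 : ℝ)) := by
        gcongr
    _ = 3840 * (C₆ * |B| * W * Cτ) * M₅ * bigP D ^ 2 *
          ((D : ℝ) ^ (1 / 8 : ℝ) * (D : ℝ) ^ (-(3 / 8 : ℝ))) := by ring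
    _ = 3840 * (C₆ * |B| * W * Cτ) * M₅ * bigP D ^ 2 * (D : ℝ) ^ (-(1 / 4 : ℝ)) := by
        rw [← Real.rpow_add hD0]; norm_num

/-! ## W-146 and (14.6) by name -/

/-- **W-146 HOLDS** — the weighted (14.6): for every `B` there are `c > 0`, `C` with, for all large `D`
under (A), all `‖β‖ < 5α`, all `κ*, a*` subject to (14.1)–(14.2) and every `D = D₁D₂`, `D₁ > 1`,
`‖Σ_{p∼P} χ(p)(pt₀)^β 𝒮(D₁,D₂;p)‖ ≤ C·P²·D^{1/2−c}` (hypothesis `h146` of `prop141_of_parts`, third input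
of `prop141_of_legs`): `eq146W_of_legs leg1₂_holds leg2₂_holds`.
[cite: Zhang2022LandauSiegel, §14 (14.6) p.78, tex L3915; p.76 tex L3849] -/
theorem eq146W_holds :
    ∀ B : ℝ, ∃ c : ℝ, 0 < c ∧ ∃ C : ℝ, ForAllLarge fun D _ χ => AssumptionA D χ →
      ∀ β : ℂ, ‖β‖ < 5 * alpha D → ∀ κs as : ℕ → ℂ, Eq141 B κs → Eq142 D B as →
        ∀ D₁ D₂ : ℕ, D₁ * D₂ = D → 1 < D₁ →
          ‖∑ p ∈ primeWindow D, χ (p : ZMod D) * wt D β p * calS D D₁ D₂ p κs as‖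
            ≤ C * bigP D ^ 2 * (D : ℝ) ^ (1 / 2 - c) :=
  eq146W_of_legs leg1₂_holds leg2₂_holds

/-- **(14.6) HOLDS AS TYPED**: `Typed.Sec14.Eq146` — "for `D = D₁D₂`, `D₁ > 1`,
`Σ_{p∼P} χ(p)𝒮(D₁,D₂;p) ≪ P²D^{1/2−c}`" (p. 78, tex L3915), the `β = 0` instance
(`eq146_of_legsW leg1₂_holds leg2₂_holds`). [cite: Zhang2022LandauSiegel, §14 (14.6) p.78, tex L3915] -/
theorem eq146_holds : Eq146 := eq146_of_legsW leg1₂_holds leg2₂_holds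

end Literature.NumberTheory.LFunctions.Zhang2022.Typed.Sec14
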